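/-
Origin: expansion seat `planner-pub-hodgecm-toy2-g6-0`, handover #1 2026-08-18T10:52:34Z (`HOME/pub-hodgecm-toy2-g6/lean/Toy2g6/ConjTwist.lean`, md5 c8f391fe, 497 lines);
landed by the gen-7 packager in gate run 28 as `HodgeCM/Model/ConjTwist.lean` (verbatim).
-/
/-
Copyright: pub-hodgecm formalisation cell (harness21, 2026). New file (not vendored).
Origin: HOME/pub-hodgecm-toy2-g6/lean/Toy2g6/ConjTwist.lean — session planner-pub-hodgecm-toy2-g6-0 (unit pub-hodgecm-toy2-g6,
CONSISTENCY seat 2, part (6a)(ii), generation 6).  WIP module `Toy2g6.ConjTwist`; intended final place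
`HodgeCM/Model/ConjTwist.lean` (module `HodgeCM.Model.ConjTwist`).  No WIP imports: nothing to rewrite on landing.
-/
import Summits.HodgeConjecture.HodgeCM.Model.PadH0FundDescent
import Summits.HodgeConjecture.HodgeCM.Proofs.Pohlmann.CupPow
import Summits.HodgeConjecture.HodgeCM.Proofs.Pohlmann.DegreeZero

/-!
# N2 `Fact_cup_hodge` is independent: conjugating the Hodge structure in selected degrees

The **conjugate** of a pure Hodge structure `(V, F)` of weight `n` is `(V, conj F)`, `(conj F)^p := conj (F^p)`: again a pure
Hodge structure of weight `n` (its pieces are `V^{q,p}`), with the SAME rational classes `V ∩ F^p = V ∩ conj F^p` (rational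
vectors are real), the same `F^0 = ⊤` test, and compatible with every `ℚ`-linear map that respected `F` (`conj` commutes with
base-changed maps).  Nothing in the axiom list compares the Hodge filtrations of DIFFERENT degrees except

* M5 `Fact_cup2_hodge` (`H^k ∪ H^k → H^{2k}`) — respected as soon as the set of twisted degrees `D` satisfies `2k ∈ D ↔ k ∈ D`;
* N2 `Fact_cup_hodge` (`H^i ∪ H^j → H^{i+j}`) — which FAILS: with `H¹, H²` untouched and `H³` conjugated, N2 for the twisted
  universe together with N2, N4 for the original one forces `H² ∪ H¹ = 0` (`ConjTwist.cupC_two_one_eq_zero`: split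
  `H²_ℂ = F¹ ⊕ conj F²` and `H¹_ℂ = F¹ ⊕ conj F¹`; each product lands in `F² H³ ∩ conj F² H³ = 0`), contradicting N1
  (`⋀³ H¹ ≅ H³` via cup) on any CM product with `H³ ≠ 0`.

Degrees `0, 1, 2` are never twisted (`degTwist`), so everything the axioms say about `H¹` (CM actions, eigenlines, `H^{1,0}`),
`H²` (Weil lines, `F² H²`, theta realisations) and `H⁰` is literally unchanged, and `hodgeClassesOf` — hence `alg ≤ hodge`,
Lefschetz (1,1), `HC`, `HC_CM`, `PohlmannSpan` — is unchanged in every degree.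

* `HodgeCM.ConjTwist.conjHodge H` — the conjugate Hodge structure, `conjHodge_hodgeClasses`, `conjHodge_piece`;
* `Universe.conjTwist U D := {U with hodge X k := conj (hodge X k) if degTwist D k}` — generic, for ANY universe and ANY
  `D : ℕ → Bool` (masked to `false` in degrees `0, 1, 2`);
* `ConjTwist.modelAxioms : U.ModelAxioms → (∀ k, degTwist D (k+k) = degTwist D k) → (U.conjTwist D).ModelAxioms` and the
  transfer of N1, N3, N4, F2, F4, F5, F6, F7, F7d, F7d-B, `Fact_unitH0`, N5, `Fact_dimProd`, `Fact_H0_rank`, M29, `W_RK4`,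
  `PohlmannSpan`, `Qw8Sufficiency`, `Qw8MilnePos`, `CMProdH0Nontrivial`, `CMProdConnected`, `HC_CM`, `RealisationExistsPerL/Face`;
* `ConjTwist.not_fact_cup_hodge`: if `degTwist D 3 = true` and `U` satisfies N1, N2, N4 and has a CM product with `H³ ≠ 0`,
  then **N2 FAILS in `U.conjTwist D`**;
* `ConjTwist.not_fact_weightHodge`: under the same hypotheses plus M29/M30 for `U`, the derived fact M30 `Fact_weightHodge`
  FAILS in `U.conjTwist D` too (every weight space of `H³` would lie in `H^{p,q} ∩ H^{q,p} = 0`, `p + q = 3`), although M29,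
  N1, N3, N4 and all `ModelAxioms` hold there: N2 is a necessary hypothesis of `weightHodge_of_facts`.

The toy instance (`D k := 3 ∣ k`, the exterior model, `H³(A_{(ℚ(ζ₇),Φ)}) = ⋀³ ℚ⁶ ≠ 0`) and the independence statement are in
`Toy2g6.ToyConjTwist` (→ `HodgeCM/Model/Toy/ToyConjTwist.lean`).  FACTS §1c P5 row N2 ('none filed').
Nothing is cited; Lean + Mathlib axioms only.
-/

noncomputable section

open scoped TensorProduct

namespace HodgeCM

open Literature.AlgebraicGeometry.Motives (CMType HodgeStructure)
open Literature.AlgebraicGeometry.Motives.HodgeStructure (conj ofRat complexConj conj_conj conj_ofRat mem_complexConj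
  complexConj_complexConj complexConj_top complexConj_bot complexConj_mono complexConj_inf conj_baseChange)

/-! ### The conjugate Hodge structure -/

namespace ConjTwist

variable {V : Type} [AddCommGroup V] [Module ℚ V] {n : ℤ}

/-- `conj W = ⊤ ↔ W = ⊤`. -/
theorem complexConj_eq_top_iff (W : Submodule ℂ (ℂ ⊗[ℚ] V)) : complexConj W = ⊤ ↔ W = ⊤ := by
  constructor
  · intro h
    rw [← complexConj_complexConj W, h, complexConj_top]
  · intro h
    rw [h, complexConj_top]

/-- **The conjugate Hodge structure** `(V, conj F)`: `(conj F)^p = conj (F^p)`.  Opposedness of `conj F` and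
`conj (conj F) = F` in weight `n` is opposedness of `F` and `conj F` with the roles of `p` and `q` exchanged. -/
def conjHodge (H : HodgeStructure V n) : HodgeStructure V n where
  F p := complexConj (H.F p)
  antitone_F := fun _ _ h => complexConj_mono (H.antitone_F h)
  exists_F_eq_top := by
    obtain ⟨p, hp⟩ := H.exists_F_eq_top
    exact ⟨p, by rw [hp, complexConj_top]⟩
  exists_F_eq_bot := by
    obtain ⟨p, hp⟩ := H.exists_F_eq_bot
    exact ⟨p, by rw [hp, complexConj_bot]⟩
  isCompl_F_complexConj p q h := by
    rw [complexConj_complexConj]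
    exact (H.isCompl_F_complexConj q p (by omega)).symm

/-- (Ported verbatim from the HodgeCMPerL package; no docstring in the source.) -/
theorem conjHodge_F (H : HodgeStructure V n) (p : ℤ) : (conjHodge H).F p = complexConj (H.F p) := rfl

/-- (Ported verbatim from the HodgeCMPerL package; no docstring in the source.) -/
theorem mem_conjHodge_F {H : HodgeStructure V n} {p : ℤ} {x : ℂ ⊗[ℚ] V} : x ∈ (conjHodge H).F p ↔ conj x ∈ H.F p :=
  Iff.rfl

/-- The conjugate structure has the same rational classes in every filtration level (rational classes are real). -/
theorem conjHodge_hodgeClasses (H : HodgeStructure V n) (p : ℤ) : (conjHodge H).hodgeClasses p = H.hodgeClasses p := by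
  ext v
  rw [HodgeStructure.mem_hodgeClasses_iff, HodgeStructure.mem_hodgeClasses_iff, mem_conjHodge_F, conj_ofRat]

/-- `(conj F)^p = ⊤ ↔ F^p = ⊤`. -/
theorem conjHodge_F_eq_top_iff (H : HodgeStructure V n) (p : ℤ) : (conjHodge H).F p = ⊤ ↔ H.F p = ⊤ :=
  complexConj_eq_top_iff _

/-- The pieces of the conjugate structure: `(conj H)^{p,q} = H^{q,p}`. -/
theorem conjHodge_piece (H : HodgeStructure V n) (p q : ℤ) : (conjHodge H).piece p q = H.piece q p := by
  by_cases h : p + q = n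
  · rw [HodgeStructure.piece_of_add_eq _ h, HodgeStructure.piece_of_add_eq _ ((add_comm q p).trans h), conjHodge_F,
      conjHodge_F, complexConj_complexConj, inf_comm]
  · rw [HodgeStructure.piece_eq_bot_of_add_ne _ h,
      HodgeStructure.piece_eq_bot_of_add_ne _ (fun h' => h ((add_comm p q).trans h'))]

/-- In weight `n`, two pieces `H^{p,q}` and `H^{q,p}` with `p ≠ q` meet in `0`. -/
theorem piece_inf_piece_swap_eq_bot (H : HodgeStructure V n) {p q : ℤ} (hpq : p ≠ q) : H.piece p q ⊓ H.piece q p = ⊥ := by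
  by_cases h : p + q = n
  · rcases lt_or_gt_of_ne hpq with hlt | hlt
    · -- `q` is the larger index: `H^{q,p} ≤ F^q`, `H^{p,q} ≤ conj F^q ≤ conj F^{n+1-q}`
      have hc : (H.F q) ⊓ complexConj (H.F (n + 1 - q)) = ⊥ := (H.isCompl_F_complexConj q (n + 1 - q) (by omega)).inf_eq_bot
      rw [eq_bot_iff, ← hc]
      exact le_inf ((inf_le_right).trans (H.piece_le_F q p))
        ((inf_le_left).trans ((H.piece_le_complexConj_F p q).trans (complexConj_mono (H.antitone_F (by omega)))))
    · have hc : (H.F p) ⊓ complexConj (H.F (n + 1 - p)) = ⊥ := (H.isCompl_F_complexConj p (n + 1 - p) (by omega)).inf_eq_bot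
      rw [eq_bot_iff, ← hc]
      exact le_inf ((inf_le_left).trans (H.piece_le_F p q))
        ((inf_le_right).trans ((H.piece_le_complexConj_F q p).trans (complexConj_mono (H.antitone_F (by omega)))))
  · rw [HodgeStructure.piece_eq_bot_of_add_ne _ h, bot_inf_eq]

end ConjTwist

/-! ### The degree selector -/

/-- The twisted degrees: `D`, masked to `false` in degrees `0, 1, 2` (so that `H⁰, H¹, H²` are never touched and the mask
reduces by evaluation at the literal degrees the axioms mention). -/
def degTwist (D : ℕ → Bool) : ℕ → Bool
  | 0 => false
  | 1 => false
  | 2 => false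
  | k + 3 => D (k + 3)

/-- (Ported verbatim from the HodgeCMPerL package; no docstring in the source.) -/
@[simp] theorem degTwist_zero (D : ℕ → Bool) : degTwist D 0 = false := rfl
/-- (Ported verbatim from the HodgeCMPerL package; no docstring in the source.) -/
@[simp] theorem degTwist_one (D : ℕ → Bool) : degTwist D 1 = false := rfl
/-- (Ported verbatim from the HodgeCMPerL package; no docstring in the source.) -/
@[simp] theorem degTwist_two (D : ℕ → Bool) : degTwist D 2 = false := rfl
/-- (Ported verbatim from the HodgeCMPerL package; no docstring in the source.) -/
theorem degTwist_add_three (D : ℕ → Bool) (k : ℕ) : degTwist D (k + 3) = D (k + 3) := rfl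

/-- (Ported verbatim from the HodgeCMPerL package; no docstring in the source.) -/
theorem degTwist_of_three_le (D : ℕ → Bool) {k : ℕ} (h : 3 ≤ k) : degTwist D k = D k := by
  obtain ⟨j, rfl⟩ := Nat.exists_eq_add_of_le h
  rw [Nat.add_comm]
  rfl

namespace Universe

variable {U : Universe} {D : ℕ → Bool}

/-- The Hodge structure of `U.conjTwist D` on `H^k(X)`: conjugated iff `degTwist D k`. -/
def twistHodge (U : Universe) (D : ℕ → Bool) (X : U.Var) (k : ℕ) : HodgeStructure (U.Coh X k) (k : ℤ) :=
  bif degTwist D k then ConjTwist.conjHodge (U.hodge X k) else U.hodge X k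

/-- **The conjugate-twisted universe**: same varieties, cohomology, maps, cup products, traces, algebraic classes, CM data;
the Hodge structure on `H^k(X)` is replaced by its conjugate in the degrees `k ≥ 3` selected by `D`. -/
abbrev conjTwist (U : Universe) (D : ℕ → Bool) : Universe :=
  { U with hodge := U.twistHodge D }

namespace ConjTwist

/-- (Ported verbatim from the HodgeCMPerL package; no docstring in the source.) -/
theorem twistHodge_of_false {X : U.Var} {k : ℕ} (h : degTwist D k = false) : U.twistHodge D X k = U.hodge X k := by
  rw [twistHodge, h]
  rfl

/-- (Ported verbatim from the HodgeCMPerL package; no docstring in the source.) -/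
theorem twistHodge_of_true {X : U.Var} {k : ℕ} (h : degTwist D k = true) :
    U.twistHodge D X k = ConjTwist.conjHodge (U.hodge X k) := by
  rw [twistHodge, h]
  rfl

/-- (Ported verbatim from the HodgeCMPerL package; no docstring in the source.) -/
theorem hodge_eq (X : U.Var) (k : ℕ) : (U.conjTwist D).hodge X k = U.twistHodge D X k := rfl

/-- Rational classes of filtration level `p` are the same in `U` and `U.conjTwist D`, in every degree. -/
theorem twistHodge_hodgeClasses (X : U.Var) (k : ℕ) (p : ℤ) :
    (U.twistHodge D X k).hodgeClasses p = (U.hodge X k).hodgeClasses p := by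
  cases h : degTwist D k
  · rw [twistHodge_of_false h]
  · rw [twistHodge_of_true h, ConjTwist.conjHodge_hodgeClasses]

/-- (Ported verbatim from the HodgeCMPerL package; no docstring in the source.) -/
theorem hodgeClassesOf_eq (X : U.Var) (p : ℕ) : (U.conjTwist D).hodgeClassesOf X p = U.hodgeClassesOf X p :=
  twistHodge_hodgeClasses X (2 * p) p

set_option smartUnfolding false in
/-- (Ported verbatim from the HodgeCMPerL package; no docstring in the source.) -/
theorem hc_iff (X : U.Var) : (U.conjTwist D).HC X ↔ U.HC X := by
  refine forall_congr' fun p => ?_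
  rw [hodgeClassesOf_eq]

set_option smartUnfolding false in
/-- (Ported verbatim from the HodgeCMPerL package; no docstring in the source.) -/
theorem hc_cm_iff : (U.conjTwist D).HC_CM ↔ U.HC_CM := by
  refine forall_congr' fun X => ?_
  change (U.IsCMAbelianVariety X → (U.conjTwist D).HC X) ↔ (U.IsCMAbelianVariety X → U.HC X)
  rw [hc_iff]

/-! ### The five `ModelAxioms` that mention a Hodge filtration: M4, M5, M7, M10, M16 -/

set_option smartUnfolding false in
/-- M4: pull-backs respect `conj F` because `conj` commutes with base-changed maps. -/
theorem pull_hodge (h : U.Fact_pull_hodge) : (U.conjTwist D).Fact_pull_hodge := by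
  intro X Y f k p
  change ((U.twistHodge D Y k).F p).map (U.pullC f k) ≤ (U.twistHodge D X k).F p
  cases hk : degTwist D k
  · rw [twistHodge_of_false hk, twistHodge_of_false hk]
    exact h X Y f k p
  · rw [twistHodge_of_true hk, twistHodge_of_true hk]
    rintro _ ⟨x, hx, rfl⟩
    change conj (U.pullC f k x) ∈ (U.hodge X k).F p
    rw [pullC, conj_baseChange]
    exact h X Y f k p ⟨conj x, hx, rfl⟩

set_option smartUnfolding false in
/-- M5: `H^k ∪ H^k → H^{2k}` respects the twisted filtrations as soon as `2k` is twisted iff `k` is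
(`conj (x ∪ y) = conj x ∪ conj y`). -/
theorem cup2_hodge (hD : ∀ k, degTwist D (k + k) = degTwist D k) (h : U.Fact_cup2_hodge) :
    (U.conjTwist D).Fact_cup2_hodge := by
  intro X k p q x y hx hy
  change U.cup2C X k x y ∈ (U.twistHodge D X (k + k)).F (p + q)
  change x ∈ (U.twistHodge D X k).F p at hx
  change y ∈ (U.twistHodge D X k).F q at hy
  cases hk : degTwist D k
  · rw [twistHodge_of_false hk] at hx hy
    rw [twistHodge_of_false ((hD k).trans hk)]
    exact h X k p q x y hx hy
  · rw [twistHodge_of_true hk] at hx hy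
    rw [twistHodge_of_true ((hD k).trans hk)]
    change conj (U.cup2C X k x y) ∈ (U.hodge X (k + k)).F (p + q)
    rw [cup2C_eq_cupC, conj_cupC, ← cup2C_eq_cupC]
    exact h X k p q (conj x) (conj y) hx hy

set_option smartUnfolding false in
/-- (Ported verbatim from the HodgeCMPerL package; no docstring in the source.) -/
theorem alg_le_hodge (h : U.Fact_alg_le_hodge) : (U.conjTwist D).Fact_alg_le_hodge := by
  intro X p
  rw [hodgeClassesOf_eq]
  exact h X p

set_option smartUnfolding false in
/-- (Ported verbatim from the HodgeCMPerL package; no docstring in the source.) -/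
theorem lefschetz11 (h : U.Fact_Lefschetz11) : (U.conjTwist D).Fact_Lefschetz11 := by
  intro X
  rw [hodgeClassesOf_eq]
  exact h X

set_option smartUnfolding false in
/-- (Ported verbatim from the HodgeCMPerL package; no docstring in the source.) -/
theorem weilLine_hodge (h : U.Fact_weilLine_hodge) : (U.conjTwist D).Fact_weilLine_hodge := by
  intro K f
  rw [hodgeClassesOf_eq]
  exact h K f

set_option smartUnfolding false in
/-- **All 28 `ModelAxioms` transfer to `U.conjTwist D`** when the twisted degrees are stable under `k ↦ 2k` in both
directions (23 by definitional unfolding — `H¹`, `H²` are untouched —, M4/M5/M7/M10/M16 by the lemmas above). -/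
theorem modelAxioms (M : U.ModelAxioms) (hD : ∀ k, degTwist D (k + k) = degTwist D k) : (U.conjTwist D).ModelAxioms where
  pull_id := M.pull_id
  pull_comp := M.pull_comp
  pull_cup := M.pull_cup
  pull_hodge := pull_hodge M.pull_hodge
  cup2_hodge := cup2_hodge hD M.cup2_hodge
  tr_degree := M.tr_degree
  alg_le_hodge := alg_le_hodge M.alg_le_hodge
  pull_alg := M.pull_alg
  cup_alg := M.cup_alg
  lefschetz11 := lefschetz11 M.lefschetz11
  cmAV := M.cmAV
  eigenLine := M.eigenLine
  alphaLine := M.alphaLine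
  cmDominated := M.cmDominated
  weilLine_rank := M.weilLine_rank
  weilLine_hodge := weilLine_hodge M.weilLine_hodge
  pms_dim := M.pms_dim
  lift := M.lift
  cup_comm1 := M.cup_comm1
  cup_interchange := M.cup_interchange
  kunneth1 := M.kunneth1
  H1_rank := M.H1_rank
  H4_span := M.H4_span
  cmEnd := M.cmEnd
  conjIsogeny := M.conjIsogeny
  gysin_surface := M.gysin_surface
  deg_diag := M.deg_diag
  algDuality := M.algDuality

/-! ### The inputs that do not mention a Hodge filtration of degree `≥ 3` transfer definitionally -/

set_option smartUnfolding false in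
/-- (Ported verbatim from the HodgeCMPerL package; no docstring in the source.) -/
theorem fact_cupExterior_iff : (U.conjTwist D).Fact_cupExterior ↔ U.Fact_cupExterior := Iff.rfl
set_option smartUnfolding false in
/-- (Ported verbatim from the HodgeCMPerL package; no docstring in the source.) -/
theorem fact_pull_H0_iff : (U.conjTwist D).Fact_pull_H0 ↔ U.Fact_pull_H0 := Iff.rfl
set_option smartUnfolding false in
/-- (Ported verbatim from the HodgeCMPerL package; no docstring in the source.) -/
theorem fact_factorActDescends_iff : (U.conjTwist D).Fact_factorActDescends ↔ U.Fact_factorActDescends := Iff.rfl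
set_option smartUnfolding false in
/-- (Ported verbatim from the HodgeCMPerL package; no docstring in the source.) -/
theorem fact_cupAlg_iff : (U.conjTwist D).Fact_cupAlg ↔ U.Fact_cupAlg := Iff.rfl
set_option smartUnfolding false in
/-- (Ported verbatim from the HodgeCMPerL package; no docstring in the source.) -/
theorem fact_cupAssoc_iff : (U.conjTwist D).Fact_cupAssoc ↔ U.Fact_cupAssoc := Iff.rfl
set_option smartUnfolding false in
/-- (Ported verbatim from the HodgeCMPerL package; no docstring in the source.) -/
theorem fact_weightDual_iff : (U.conjTwist D).Fact_weightDual ↔ U.Fact_weightDual := Iff.rfl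
set_option smartUnfolding false in
/-- (Ported verbatim from the HodgeCMPerL package; no docstring in the source.) -/
theorem fact_gysin_iff : (U.conjTwist D).Fact_gysin ↔ U.Fact_gysin := Iff.rfl
set_option smartUnfolding false in
/-- (Ported verbatim from the HodgeCMPerL package; no docstring in the source.) -/
theorem fact_gysinDescent_iff : (U.conjTwist D).Fact_gysinDescent ↔ U.Fact_gysinDescent := Iff.rfl
set_option smartUnfolding false in
/-- (Ported verbatim from the HodgeCMPerL package; no docstring in the source.) -/
theorem fact_gysinDescentB_iff : (U.conjTwist D).Fact_gysinDescentB ↔ U.Fact_gysinDescentB := Iff.rfl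
set_option smartUnfolding false in
/-- (Ported verbatim from the HodgeCMPerL package; no docstring in the source.) -/
theorem fact_unitH0_iff : (U.conjTwist D).Fact_unitH0 ↔ U.Fact_unitH0 := Iff.rfl
set_option smartUnfolding false in
/-- (Ported verbatim from the HodgeCMPerL package; no docstring in the source.) -/
theorem fact_fundClass_iff : (U.conjTwist D).Fact_fundClass ↔ U.Fact_fundClass := Iff.rfl
set_option smartUnfolding false in
/-- (Ported verbatim from the HodgeCMPerL package; no docstring in the source.) -/
theorem fact_dimProd_iff : (U.conjTwist D).Fact_dimProd ↔ U.Fact_dimProd := Iff.rfl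
set_option smartUnfolding false in
/-- (Ported verbatim from the HodgeCMPerL package; no docstring in the source.) -/
theorem fact_H0_rank_iff : (U.conjTwist D).Fact_H0_rank ↔ U.Fact_H0_rank := Iff.rfl
set_option smartUnfolding false in
/-- (Ported verbatim from the HodgeCMPerL package; no docstring in the source.) -/
theorem fact_weightSpan_iff : (U.conjTwist D).Fact_weightSpan ↔ U.Fact_weightSpan := Iff.rfl
set_option smartUnfolding false in
/-- (Ported verbatim from the HodgeCMPerL package; no docstring in the source.) -/
theorem w_RK4_iff : (U.conjTwist D).W_RK4 ↔ U.W_RK4 := Iff.rfl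
set_option smartUnfolding false in
/-- (Ported verbatim from the HodgeCMPerL package; no docstring in the source.) -/
theorem qw8Sufficiency_iff : (U.conjTwist D).Qw8Sufficiency ↔ U.Qw8Sufficiency := Iff.rfl
set_option smartUnfolding false in
/-- (Ported verbatim from the HodgeCMPerL package; no docstring in the source.) -/
theorem cmProdH0Nontrivial_iff : (U.conjTwist D).CMProdH0Nontrivial ↔ U.CMProdH0Nontrivial := Iff.rfl
set_option smartUnfolding false in
/-- (Ported verbatim from the HodgeCMPerL package; no docstring in the source.) -/
theorem cmProdConnected_iff : (U.conjTwist D).CMProdConnected ↔ U.CMProdConnected := Iff.rfl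

/-! ### N4, `PohlmannSpan`, `Qw8MilnePos`, the realisation inputs transfer -/

set_option smartUnfolding false in
/-- N4 transfers: `conj F⁰ = ⊤ ↔ F⁰ = ⊤`. -/
theorem fact_hodge_F0_iff : (U.conjTwist D).Fact_hodge_F0 ↔ U.Fact_hodge_F0 := by
  refine forall_congr' fun X => forall_congr' fun k => ?_
  change (U.twistHodge D X k).F 0 = ⊤ ↔ (U.hodge X k).F 0 = ⊤
  cases hk : degTwist D k
  · rw [twistHodge_of_false hk]
  · rw [twistHodge_of_true hk]
    exact ConjTwist.conjHodge_F_eq_top_iff _ _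

set_option smartUnfolding false in
/-- `PohlmannSpan` transfers (it only mentions `hodgeClassesOf`). -/
theorem pohlmannSpan_iff : (U.conjTwist D).PohlmannSpan ↔ U.PohlmannSpan := by
  refine forall_congr' fun F => forall_congr' fun _ => forall_congr' fun _ => forall_congr' fun n =>
    forall_congr' fun Θ => forall_congr' fun p => ?_
  rw [hodgeClassesOf_eq]
  exact Iff.rfl

set_option smartUnfolding false in
/-- Weight-vector records of `U.conjTwist D` and of `U` are the same data. -/
def wvecOf {F : CMField} (z : (U.conjTwist D).WVec F) : U.WVec F :=
  ⟨z.n, z.Θ, z.p, z.S, z.x, z.ne_zero, z.isWeightVector⟩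

set_option smartUnfolding false in
/-- `Qw8MilnePos` transfers (it does not mention Hodge filtrations). -/
theorem qw8MilnePos (h : U.Qw8MilnePos) : (U.conjTwist D).Qw8MilnePos := fun F hG h6 z hp ha => h F hG h6 (wvecOf z) hp ha

set_option smartUnfolding false in
/-- Theta realisations live in degrees `1, 2` only: they transfer. -/
theorem realisationExistsFace (h : U.RealisationExistsFace) : (U.conjTwist D).RealisationExistsFace := by
  intro F hG h6 f ι₁ hf V
  obtain ⟨r⟩ := h F hG h6 f ι₁ hf V
  exact ⟨{ r with }⟩


-- port_pkg: scope closed for this part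
end ConjTwist
end Universe
end HodgeCM
end
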